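import Summits.AtomisticToContinuum.HydrodynamicLimit.Theses.AnosovDiceHopf
import Summits.AtomisticToContinuum.HydrodynamicLimit.Theses.AnosovRotorDice
import Summits.AtomisticToContinuum.HydrodynamicLimit.Theorems.StiffCollisionalRelaxationAprioriBoundsEntropyRange
import Literature.MathematicalPhysics.KineticTheory.HardSphereEuler
import HarnessLib

/-!
# The velocity LLN of component (i) of the crux `AprioriBounds` from the one-body local-Maxwellian LLN
(line `Sketch`, crux `StiffCollisionalRelaxation.AprioriBounds`, stmt-AtomisticToContinuum-14827)

Helper file (`--supports stmt-AtomisticToContinuum-14827`), stub `velocityLLN_of_maxwellianOneBody`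
(dock of reshape r7 of the line skeleton).

Reshape r7 of the crux splits its component (i) into an expected Gaussian velocity moment and a
fixed-time law of large numbers for bounded continuous VELOCITY statistics: under the crux prefix
"profiles → `∃ σ₀ ∃ η₁ ∀ σ < σ₀` → classical hs-Euler solution on `[0, T)` → flow family with the
`t = 0` LLN → `0 < t < T` with the chamber `2ρσ³ < η₁` on `[0, t]`", for every bounded continuous
`ψ : ℝ³ → ℝ` and every fixed `s ∈ [0, t]` there is a deterministic `m` with
`P_N{δ < |∫ ψ(v) d(empirical measure of Φ_s z) − m|} → 0` for every `δ > 0`.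

This file docks this LLN to the ONE-BODY LOCAL-MAXWELLIAN LAW OF LARGE NUMBERS: for every
`t ∈ [0, T)`, every bounded continuous `ψ : 𝕋³ × ℝ³ → ℝ` and every `δ > 0`,
`P_N{δ < |∫ ψ d(empirical measure of Φ_t z) − ∫ ρ_t(x) ∫ ψ(x,v) M_{1,u_t(x),θ_t(x)}(v) dv dx|} → 0`,
in its two typed forms:

* `stub_velocityLLN_of_maxwellianOneBodyInBand` — from the LIVE route item
  `AnosovDiceHopf.MaxwellianOneBodyInBand` (stmt-AtomisticToContinuum-17603; the statement asks the
  LLN only along classical solutions whose packing fraction stays in a band `ρσ³ < η₀` on `[0, T)`,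
  `η₀` outermost). Glue: `σ₀` from the item, `η₁ := η₀`; the crux's chamber `2ρσ³ < η₁` on the
  closed slab `[0, t]` gives `ρσ³ < η₀` there, hence on `[0, t')` for some `t' ∈ (t, T]`
  (`exists_chamber_extension`, file `…AprioriBoundsEntropyRange.lean`); the solution restricted to
  `[0, t')` (`IsHardSphereEulerSolution.restrict`) is in the band, and the item at the time
  `s ∈ [0, t] ⊆ [0, t')` with the phase-space statistic `ψ ∘ Prod.snd` gives the LLN with
  `m := ∫ ρ_s(x) ∫ ψ(v) M_{1,u_s(x),θ_s(x)}(v) dv dx`.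
* `stub_velocityLLN_of_maxwellianOneBodyUnguarded` — from the UNGUARDED one-body LLN (no packing
  band; `η₁ := 1`, the chamber unused), the statement this file was written against.

Maintenance note (full-build repair 2026-08-17; the mathematics of the original dock is unchanged).
The file landed (p123817) as `stub_velocityLLN_of_maxwellianOneBody :
AnosovDiceHopf.MaxwellianOneBody → …` against the route item stmt-AtomisticToContinuum-14290. The
route repair of `AnosovDiceHopf` (rev 12, 2026-08-16T23:23:30Z, after the statement re-type
p126922) RETIRED that decl in favour of the in-band `MaxwellianOneBodyInBand` (stmt-17603), so the
name `AnosovDiceHopf.MaxwellianOneBody` no longer exists and the file stopped elaborating. The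
retired statement is still declared in the tree VERBATIM (ledger signature of stmt-14290 =
stmt-4742, checked character for character) as `AnosovRotorDice.MaxwellianOneBody` (kept file of
the closed route `AnosovRotorDice`), shared here rather than re-declared: the original theorem keeps
its proof text against that decl under the new name `stub_velocityLLN_of_maxwellianOneBodyUnguarded`,
and `stub_velocityLLN_of_maxwellianOneBody` survives as its deprecated alias (append-only:
deprecate, don't mutate — the same device as `Theorems/InformationPercolationEngineAssembly.lean`).

No new definitions, no named facts; axioms `propext`, `Classical.choice`, `Quot.sound`.
-/

noncomputable section

open MeasureTheory Filter Set Topology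
open scoped ENNReal

namespace Summit.AtomisticToContinuum.HydrodynamicLimit.Theorems.AdiabatCeiling

open Literature.MathematicalPhysics.KineticTheory Literature.Analysis.FluidPDE

/-- **Dock of the velocity LLN of component (i) to `AnosovDiceHopf.MaxwellianOneBodyInBand`**
(stmt-AtomisticToContinuum-17603, the live in-band item).  The one-body local-Maxwellian law of
large numbers in the packing band `ρσ³ < η₀` implies, under the crux prefix of
`StiffCollisionalRelaxation.AprioriBounds` with `η₁ := η₀`, that at every fixed time `s ∈ [0, t]`,
`0 < t < T`, every bounded continuous velocity statistic `∫ ψ(v) d(empirical measure of Φ_s z)`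
converges in `P_N`-probability to `m := ∫ ρ_s(x) ∫ ψ(v) M_{1,u_s(x),θ_s(x)}(v) dv dx`.  The chamber
`2ρσ³ < η₀` on `[0, t]` puts `ρσ³ < η₀` on `[0, t]`, hence on some `[0, t')`, `t < t' ≤ T`
(`exists_chamber_extension`); the item is applied to the solution restricted to `[0, t')`
(`IsHardSphereEulerSolution.restrict`), at the time `s < t'`, with the statistic `ψ ∘ Prod.snd`. -/
theorem stub_velocityLLN_of_maxwellianOneBodyInBand :
    Summit.AtomisticToContinuum.HydrodynamicLimit.Theses.AnosovDiceHopf.MaxwellianOneBodyInBand →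
    ∀ (a₀ θ₀ : T3 → ℝ) (u₀ : T3 → V3), Continuous a₀ → Continuous θ₀ → Continuous u₀ →
      (∀ x, 0 < a₀ x) → (∀ x, 0 < θ₀ x) →
      ∃ σ₀ : ℝ, 0 < σ₀ ∧ ∃ η₁ : ℝ, 0 < η₁ ∧ ∀ σ : ℝ, 0 < σ → σ < σ₀ →
        ∀ (T : ℝ) (ρ θ : ℝ → T3 → ℝ) (u : ℝ → T3 → V3), IsHardSphereEulerSolution σ T ρ u θ →
        ∀ Φ : (N : ℕ) → HardSphereFlow (Torus.geometry (Fin 3)) (hsDiameter σ N) (N + 1),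
          TendstoHydroFieldsAt (fun N => localGibbsLaw σ a₀ u₀ θ₀ N (Φ N)) Φ ρ u θ 0 →
          ∀ t : ℝ, 0 < t → t < T → (∀ s ∈ Icc 0 t, ∀ x, 2 * ρ s x * σ ^ 3 < η₁) →
            ∀ ψ : V3 → ℝ, Continuous ψ → (∃ B : ℝ, ∀ v, |ψ v| ≤ B) → ∀ s ∈ Icc 0 t, ∃ m : ℝ,
              ∀ δ : ℝ, 0 < δ → Tendsto (fun N : ℕ => localGibbsLaw σ a₀ u₀ θ₀ N (Φ N)
                {z | δ < |(∫ y, ψ y.2 ∂(empiricalMeasure ((Φ N).flow s z))) - m|}) atTop (𝓝 0) := by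
  rintro ⟨η₀, hη₀, h⟩ a₀ θ₀ u₀ ha hθ hu ha0 hθ0
  obtain ⟨σ₀, hσ₀, hmain⟩ := h a₀ θ₀ u₀ ha hθ hu ha0 hθ0
  refine ⟨σ₀, hσ₀, η₀, hη₀, ?_⟩
  intro σ hσ hσσ₀ T ρ θ u hsol Φ h0 t ht htT hchamber ψ hψ hB s hs
  obtain ⟨B, hB⟩ := hB
  -- the chamber `2ρσ³ < η₀` on the closed slab puts the slab in the band `ρσ³ < η₀`
  have hband : ∀ s' ∈ Icc 0 t, ∀ x, ρ s' x * σ ^ 3 < η₀ := fun s' hs' x => by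
    have h2 := hchamber s' hs' x
    rcases le_or_gt 0 (ρ s' x * σ ^ 3) with hnn | hneg
    · linarith
    · exact hneg.trans hη₀
  -- extend the band slightly past `t` and restrict the solution
  obtain ⟨t', htt', ht'T, hband'⟩ := exists_chamber_extension hsol hσ ht.le htT hband
  refine ⟨∫ x, ρ s x * ∫ v, ψ v * localMaxwellian 1 (θ s x) (u s x) v, ?_⟩
  intro δ hδ
  exact hmain σ hσ hσσ₀ t' ρ θ u (hsol.restrict ht'T) hband' Φ h0 s ⟨hs.1, hs.2.trans_lt htt'⟩
    (fun y => ψ y.2) (hψ.comp continuous_snd) ⟨B, fun y => hB y.2⟩ δ hδ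

/-- **Dock of the velocity LLN of component (i) to the unguarded one-body local-Maxwellian LLN**
(the statement of the retired item stmt-AtomisticToContinuum-14290 of route `AnosovDiceHopf`,
declared verbatim as `AnosovRotorDice.MaxwellianOneBody`, stmt-AtomisticToContinuum-4742).  The
one-body local-Maxwellian law of large numbers implies, under the crux prefix of
`StiffCollisionalRelaxation.AprioriBounds` (with `η₁ := 1`, the chamber being unused), that at every
fixed time `s ∈ [0, t]`, `t < T`, every bounded continuous velocity statistic
`∫ ψ(v) d(empirical measure of Φ_s z)` converges in `P_N`-probability to the deterministic constant
`m := ∫ ρ_s(x) ∫ ψ(v) M_{1,u_s(x),θ_s(x)}(v) dv dx` (the item applied to `ψ ∘ Prod.snd` at time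
`s ∈ [0, T)`).  Proof text of the original `stub_velocityLLN_of_maxwellianOneBody` (p123817),
unchanged. -/
theorem stub_velocityLLN_of_maxwellianOneBodyUnguarded :
    Summit.AtomisticToContinuum.HydrodynamicLimit.Theses.AnosovRotorDice.MaxwellianOneBody →
    ∀ (a₀ θ₀ : T3 → ℝ) (u₀ : T3 → V3), Continuous a₀ → Continuous θ₀ → Continuous u₀ →
      (∀ x, 0 < a₀ x) → (∀ x, 0 < θ₀ x) →
      ∃ σ₀ : ℝ, 0 < σ₀ ∧ ∃ η₁ : ℝ, 0 < η₁ ∧ ∀ σ : ℝ, 0 < σ → σ < σ₀ →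
        ∀ (T : ℝ) (ρ θ : ℝ → T3 → ℝ) (u : ℝ → T3 → V3), IsHardSphereEulerSolution σ T ρ u θ →
        ∀ Φ : (N : ℕ) → HardSphereFlow (Torus.geometry (Fin 3)) (hsDiameter σ N) (N + 1),
          TendstoHydroFieldsAt (fun N => localGibbsLaw σ a₀ u₀ θ₀ N (Φ N)) Φ ρ u θ 0 →
          ∀ t : ℝ, 0 < t → t < T → (∀ s ∈ Icc 0 t, ∀ x, 2 * ρ s x * σ ^ 3 < η₁) →
            ∀ ψ : V3 → ℝ, Continuous ψ → (∃ B : ℝ, ∀ v, |ψ v| ≤ B) → ∀ s ∈ Icc 0 t, ∃ m : ℝ,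
              ∀ δ : ℝ, 0 < δ → Tendsto (fun N : ℕ => localGibbsLaw σ a₀ u₀ θ₀ N (Φ N)
                {z | δ < |(∫ y, ψ y.2 ∂(empiricalMeasure ((Φ N).flow s z))) - m|}) atTop (𝓝 0) := by
  intro h a₀ θ₀ u₀ ha hθ hu ha0 hθ0
  obtain ⟨σ₀, hσ₀, hmain⟩ := h a₀ θ₀ u₀ ha hθ hu ha0 hθ0
  refine ⟨σ₀, hσ₀, 1, one_pos, ?_⟩
  intro σ hσ hσσ₀ T ρ θ u hsol Φ h0 t _ht htT _hchamber ψ hψ hB s hs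
  obtain ⟨B, hB⟩ := hB
  refine ⟨∫ x, ρ s x * ∫ v, ψ v * localMaxwellian 1 (θ s x) (u s x) v, ?_⟩
  intro δ hδ
  exact hmain σ hσ hσσ₀ T ρ θ u hsol Φ h0 s ⟨hs.1, hs.2.trans_lt htT⟩ (fun y => ψ y.2)
    (hψ.comp continuous_snd) ⟨B, fun y => hB y.2⟩ δ hδ

/-- Deprecated spelling of `stub_velocityLLN_of_maxwellianOneBodyUnguarded`: the landed dock
(p123817) read `stub_velocityLLN_of_maxwellianOneBody : AnosovDiceHopf.MaxwellianOneBody → …`; that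
route decl was retired by the `AnosovDiceHopf` repair of 2026-08-16T23:23:30Z (rev 12), so the name
now points at the same proof against the verbatim twin `AnosovRotorDice.MaxwellianOneBody` of the
retired statement (append-only: deprecate, don't mutate).  New code should use
`stub_velocityLLN_of_maxwellianOneBodyInBand` (live item) or `…Unguarded`. -/
@[deprecated stub_velocityLLN_of_maxwellianOneBodyUnguarded (since := "2026-08-17")]
alias stub_velocityLLN_of_maxwellianOneBody := stub_velocityLLN_of_maxwellianOneBodyUnguarded

end Summit.AtomisticToContinuum.HydrodynamicLimit.Theorems.AdiabatCeiling

end
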